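import Mathlib
import HarnessLib
import Summits.HubbardSuperconductivity.HubbardSuperconductivity.Theorems.KLProgrammeC4aPPKernelMidBandRow

/-!
# Route `KLProgramme` — crux C4a, S3 brick (B4) «(B4)-UMK1», «(U1)-M-LAW» kernel side, part 11: THE ONE-CALL LAW BUNDLE for the comparable-levels piece —
# for `Kr e u := ppMidKernelS β Λ κ lo e u / C`, the fifteen kernel rows of the `…Middle` laws (`…NearCausticBoxMiddle`, `…GenericArcMiddle`,
# `…GenericArcUniformMiddle`, `…LoopCircleCanonicalMiddle`) in their binder order and shapes

Cell `gate-hubbard-kl`, seat hubbard-kl-k3c3-p1 (g17; row «δμ-flow with klAngularMean constant piece»).  Companion of `ppFarKernelS_rows` (the far piece) for the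
ONE partition `P = A_s + swap A_s + M_s` (p704596).  Use:
`obtain ⟨hKd, hK2d, hK0, hK0s, hK1, hK2, hcomp, hKopp, hKc, hflatB, hKn1, hρ0, hρc, hρtail, hKs1⟩ := ppMidKernelS_lawRows … hC0 hC1 hC2 hCs hlohi hwc hw0 hwW hW' hwL`.
* **`midSRow_hK0s`** (strip value row, `8(1+2κ₀) ≤ C`); **`ppMidKernelS_lawRows`** — `q_c := 2q′` (`q′ = (2−t₁)/t₁`), `C_t := C_t⁰/C` (p709330), `D_fl := hi/t₁`, `A_fl := W·X_M`,
  `B_fl := 4(2q′+3/2)W′` (p713010), `ρm := ρᴹ/C`, `M_ρ := M_ρᴹ/C` (the family majorant with `κ₀ ↦ 1+2κ₀`, `κ₁ ↦ 2κ₁`); **`ppMidKernelS_lawConsts`** (`4 ≤ q_c`,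
  `0 ≤ C_t, A_fl, B_fl, M_ρ`); **`ppSplit_rowConstsMidS`** (the four row constants at the concrete split profile `κ₀ = 1, κ₁ = 6/t₁, κ₂ = 8388608/t₁²`).
Constants: `C₀ᴹ = (1+2κ₀)(12B₁+9)`, `C₁ᴹ = (1+2κ₀)C_P1 + 2κ₁(12B₁+9)`, `C₂ᴹ` (p708402), `Cˢᴹ = (1+2κ₀)(128B₁+72) + 16κ₁`.
Pure real analysis; nothing asserts (C), K3, the window or superconductivity.
References: BGM 2006 §2.4 (2.36) [cite: BenfattoGiulianiMastropietro2006]; FST II CPAM 51 (1998) §3 [cite: FeldmanSalmhoferTrubowitz1998].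
-/

noncomputable section

namespace Summit.HubbardSuperconductivity.HubbardSuperconductivity.Theorems.C4a

set_option linter.dupNamespace false -- summit = problem name (single-conjunct summit), D-0017

open Real Filter Set MeasureTheory intervalIntegral
open scoped Topology Interval
open Literature.MathematicalPhysics.QuantumLattice Literature.Analysis.SpecialFunctions

/-- **ROW `hK0s` FOR `M_s`**: `|M_s(e,u)/C| ≤ (max lo |u|)⁻¹` for `|e| ≤ lo ≤ Λ`, once `8(1+2κ₀) ≤ C` (`|P| ≤ 8·(max Λ |u|)⁻¹` on the strip, mid factor `≤ 1+2κ₀`).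
[cite: BenfattoGiulianiMastropietro2006, §2.4 (2.36)] -/
theorem midSRow_hK0s {βT Λ : ℝ} (hkβ : 0 < βT) (hkΛ : 0 < Λ) {sκ : ℝ → ℝ} {κ₀ : ℝ} (hkκb : ∀ t ∈ Icc (0 : ℝ) 1, |sκ t| ≤ κ₀) {lo C : ℝ} (hlo0 : 0 < lo)
    (hkloΛ : lo ≤ Λ) (hkC : 0 < C) (hC8 : 8 * (1 + 2 * κ₀) ≤ C) :
    ∀ e ∈ Icc (-lo) lo, ∀ u, |ppMidKernelS βT Λ sκ lo e u / C| ≤ (max lo |u|)⁻¹ := fun e he u => by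
  have hκ₀ : 0 ≤ κ₀ := (abs_nonneg _).trans (hkκb 0 (left_mem_Icc.2 zero_le_one))
  have heΛ : |e| ≤ Λ := (abs_le.2 ⟨he.1, he.2⟩).trans hkloΛ
  have hP := abs_ppTrueKernel_strip_le_inv_max hkβ hkΛ heΛ u
  have hm0 : 0 < max lo |u| := lt_max_of_lt_left hlo0
  have hmm : (max Λ |u|)⁻¹ ≤ (max lo |u|)⁻¹ := by
    rw [inv_le_inv₀ (lt_max_of_lt_left hkΛ) hm0]; exact max_le_max hkloΛ le_rfl
  rw [abs_div, abs_of_pos hkC, div_le_iff₀ hkC]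
  calc |ppMidKernelS βT Λ sκ lo e u| ≤ (1 + 2 * κ₀) * |ppTrueKernel βT Λ e u| := abs_ppMidKernelS_le hlo0 hkκb e u
    _ ≤ (1 + 2 * κ₀) * (8 * (max lo |u|)⁻¹) := mul_le_mul_of_nonneg_left (hP.trans (by gcongr)) (by positivity)
    _ = 8 * (1 + 2 * κ₀) * (max lo |u|)⁻¹ := by ring
    _ ≤ C * (max lo |u|)⁻¹ := mul_le_mul_of_nonneg_right hC8 (inv_nonneg.2 hm0.le)
    _ = (max lo |u|)⁻¹ * C := mul_comm _ _

section LawBundle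

variable {β Λ : ℝ} (hβ : 0 < β) (hΛ : 0 < Λ) {B₁ B₂ B₃ : ℝ} (hB₁ : ∀ x, |deriv salmhoferCutoff x| ≤ B₁) (hB₂ : ∀ x, |deriv (deriv salmhoferCutoff) x| ≤ B₂)
  (hB₃ : ∀ x, |deriv (deriv (deriv salmhoferCutoff)) x| ≤ B₃)
  {κ κ' κ'' : ℝ → ℝ} (hκ : ∀ t, HasDerivAt κ (κ' t) t) (hκ' : ∀ t, HasDerivAt κ' (κ'' t) t) (hκ''c : Continuous κ'')
  {κ₀ κ₁ κ₂ : ℝ} (hκb : ∀ t ∈ Icc 0 1, |κ t| ≤ κ₀) (hκ'b : ∀ t ∈ Icc 0 1, |κ' t| ≤ κ₁) (hκ''b : ∀ t ∈ Icc 0 1, |κ'' t| ≤ κ₂)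
  {t₁ : ℝ} (ht₀ : 0 < t₁) (ht25 : t₁ ≤ 2 / 5)
  (hκs : ∀ t, t₁ ≤ t → κ t = 0) (hκ's : ∀ t, t₁ ≤ t → κ' t = 0) (hκ''s : ∀ t, t₁ ≤ t → κ'' t = 0)
  (hκ1 : ∀ t, t ≤ t₁ / 2 → κ t = 1) (hκ'1 : ∀ t, t ≤ t₁ / 2 → κ' t = 0) (hκ''1 : ∀ t, t ≤ t₁ / 2 → κ'' t = 0)
  {lo hi C : ℝ} (hlo : 0 < lo) (hloΛ : lo ≤ Λ) (hC : 0 < C)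

set_option maxHeartbeats 400000 in
include hβ hΛ hB₁ hB₂ hB₃ hκ hκ' hκ''c hκb hκ'b hκ''b ht₀ ht25 hκs hκ's hκ''s hκ1 hκ'1 hκ''1 hlo hloΛ hC in
/-- **THE FIFTEEN KERNEL ROWS OF THE `…Middle` LAWS FOR `Kr := ppMidKernelS/C`** in their binder order and shapes (`hKd, hK2d, hK0, hK0s, hK1, hK2, hcomp, hKopp,
hKc, hflatB, hKn1, hρ0, hρc, hρtail, hKs1`), with `q_c := 2q′`, `C_t := C_t⁰/C`, `D_fl := hi/t₁`, `A_fl := W·X_M`, `B_fl := 4(2q′+3/2)W′`, `ρm := ρᴹ/C`,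
`M_ρ := M_ρᴹ/C`; normalisation `C₀ᴹ, C₁ᴹ, C₂ᴹ, Cˢᴹ ≤ C`; weight `wt` continuous and `0 ≤ wt ≤ W` on `[−hi,hi]`, `|wt e − wt lo| ≤ W′(e−lo)` on `[lo,hi]`.
[cite: BenfattoGiulianiMastropietro2006, §2.4 (2.36)] -/
theorem ppMidKernelS_lawRows (hC0 : (1 + 2 * κ₀) * (12 * B₁ + 9) ≤ C)
    (hC1 : (1 + 2 * κ₀) * (128 * B₂ + 216 * B₁ + 294 + (48 * B₁ + 28) * ((2 - t₁) / t₁)) + 2 * κ₁ * (12 * B₁ + 9) ≤ C)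
    (hC2 : (1 + 2 * κ₀) * (512 * B₃ + 1664 * B₂ + 5280 * B₁ + 3424 + (256 * B₂ + 384 * B₁ + 504) * ((2 - t₁) / t₁) ^ 2 + (192 * B₁ + 112) * ((2 - t₁) / t₁)) +
          4 * κ₁ * (128 * B₂ + 216 * B₁ + 294 + (48 * B₁ + 28) * ((2 - t₁) / t₁)) +
          (12 * B₁ + 9) * (2 * κ₂ + 2 * κ₁ * ((2 - t₁) / t₁ + 2)) ≤ C)
    (hCs : (1 + 2 * κ₀) * (128 * B₁ + 72) + 16 * κ₁ ≤ C) (hlohi : lo ≤ hi) {wt : ℝ → ℝ} {W W' : ℝ} (hwc : ContinuousOn wt (Icc (-hi) hi))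
    (hw0 : ∀ e ∈ Icc (-hi) hi, 0 ≤ wt e) (hwW : ∀ e ∈ Icc (-hi) hi, wt e ≤ W) (hW' : 0 ≤ W') (hwL : ∀ e ∈ Icc lo hi, |wt e - wt lo| ≤ W' * (e - lo)) :
    (∀ e ∈ Icc (-hi) hi, ContDiff ℝ 1 (fun v : ℝ => ppMidKernelS β Λ κ lo e v / C)) ∧
    (∀ e ∈ Icc lo hi, ContDiff ℝ 2 (fun v : ℝ => ppMidKernelS β Λ κ lo e v / C)) ∧
    (∀ e ∈ Icc (-hi) hi, e ≠ 0 → ∀ u, |ppMidKernelS β Λ κ lo e u / C| ≤ (max |e| |u|)⁻¹) ∧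
    (∀ e ∈ Icc (-lo) lo, ∀ u, |ppMidKernelS β Λ κ lo e u / C| ≤ (max lo |u|)⁻¹) ∧
    (∀ e ∈ Icc (-hi) hi, e ≠ 0 → ∀ u, |deriv (fun v : ℝ => ppMidKernelS β Λ κ lo e v / C) u| ≤ (max |e| |u|)⁻¹ ^ 2) ∧
    (∀ e ∈ Icc lo hi, ∀ u, |iteratedDeriv 2 (fun v : ℝ => ppMidKernelS β Λ κ lo e v / C) u| ≤ (max e |u|)⁻¹ ^ 3) ∧
    (∀ e ∈ Icc lo hi, ∀ u, 2 * ((2 - t₁) / t₁) * e ≤ |u| → deriv (fun v : ℝ => ppMidKernelS β Λ κ lo e v / C) u = 0) ∧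
    (∀ e ∈ Icc lo hi, ∀ u, u ≤ -(e / 4) → |deriv (fun v : ℝ => ppMidKernelS β Λ κ lo e v / C) u| ≤
      (8 * ((2 - t₁) / t₁) * (Λ / lo) * ((1 + 2 * κ₀) * (128 * B₂ + 216 * B₁ + 294 + (48 * B₁ + 28) * ((2 - t₁) / t₁)) + 2 * κ₁ * (12 * B₁ + 9)) +
          ((1 + 2 * κ₀) * (48 * ((2 - t₁) / t₁) ^ 3) + 16 * κ₁ * ((2 - t₁) / t₁) ^ 2) / (β * lo)) / C * lo * (max e |u|)⁻¹ ^ 3) ∧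
    (Continuous fun p : ℝ × ℝ => deriv (fun v : ℝ => ppMidKernelS β Λ κ lo p.1 v / C) p.2) ∧
    (∀ D : ℝ, 0 < D → D ≤ hi / t₁ →
      |∫ e in (max lo (D / (2 * ((2 - t₁) / t₁) + 3 / 2)))..(min hi (4 * D)), wt e * deriv (fun v : ℝ => ppMidKernelS β Λ κ lo e v / C) (D - e)| ≤
        W * (65 + 32 * ((2 - t₁) / t₁) * (Λ + lo) / lo + (12 * (1 + 2 * κ₀) / β + 4 * κ₁ * ((2 - t₁) / t₁) * lo + (1 + 2 * κ₀) * hi) / (C * lo)) *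
            (lo / (max D lo) ^ 2) +
          4 * (2 * ((2 - t₁) / t₁) + 3 / 2) * W') ∧
    (∀ s ∈ Icc lo hi, ∀ u, s / 2 ≤ u → |deriv (fun v : ℝ => ppMidKernelS β Λ κ lo (-s) v / C) u| ≤
      (64 * ((1 + 2 * κ₀) * (64 * B₂ + 120 * B₁ + 154) + (2 * κ₁) * (12 * B₁ + 9)) * Λ ^ 3 / (s + 2 * Λ) ^ 3 +
          ((1 + 2 * κ₀) * ((β * lo) ^ 2 + 2) + (2 * κ₁) * (β * lo + 1)) * Real.exp (-(β / 2 * s))) / C * ((max (u - s) lo)⁻¹ ^ 2)) ∧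
    (∀ s ∈ Icc lo hi, 0 ≤ (64 * ((1 + 2 * κ₀) * (64 * B₂ + 120 * B₁ + 154) + (2 * κ₁) * (12 * B₁ + 9)) * Λ ^ 3 / (s + 2 * Λ) ^ 3 +
          ((1 + 2 * κ₀) * ((β * lo) ^ 2 + 2) + (2 * κ₁) * (β * lo + 1)) * Real.exp (-(β / 2 * s))) / C) ∧
    (ContinuousOn (fun s : ℝ => (64 * ((1 + 2 * κ₀) * (64 * B₂ + 120 * B₁ + 154) + (2 * κ₁) * (12 * B₁ + 9)) * Λ ^ 3 / (s + 2 * Λ) ^ 3 +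
          ((1 + 2 * κ₀) * ((β * lo) ^ 2 + 2) + (2 * κ₁) * (β * lo + 1)) * Real.exp (-(β / 2 * s))) / C) (Icc lo hi)) ∧
    (∀ a ∈ Icc lo hi, ∫ s in a..hi, (64 * ((1 + 2 * κ₀) * (64 * B₂ + 120 * B₁ + 154) + (2 * κ₁) * (12 * B₁ + 9)) * Λ ^ 3 / (s + 2 * Λ) ^ 3 +
          ((1 + 2 * κ₀) * ((β * lo) ^ 2 + 2) + (2 * κ₁) * (β * lo + 1)) * Real.exp (-(β / 2 * s))) / C ≤
      (32 * ((1 + 2 * κ₀) * (64 * B₂ + 120 * B₁ + 154) + (2 * κ₁) * (12 * B₁ + 9)) * (Λ / lo) ^ 3 +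
          32 * ((1 + 2 * κ₀) * ((β * lo) ^ 2 + 2) + (2 * κ₁) * (β * lo + 1)) / (β * lo) ^ 3) / C * (lo * (lo / a) ^ 2)) ∧
    (∀ e ∈ Icc (-lo) lo, ∀ u, |deriv (fun v : ℝ => ppMidKernelS β Λ κ lo e v / C) u| ≤ (max lo |u|)⁻¹ ^ 2) := by
  have hB10 : 0 ≤ B₁ := salmhoferB₁_nonneg hB₁
  have hB20 : 0 ≤ B₂ := (abs_nonneg _).trans (hB₂ 0)
  have hκ₀ : 0 ≤ κ₀ := (abs_nonneg _).trans (hκb 0 (left_mem_Icc.2 zero_le_one))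
  have hκ₁ : 0 ≤ κ₁ := (abs_nonneg _).trans (hκ'b 0 (left_mem_Icc.2 zero_le_one))
  have hκ₀' : 0 ≤ 1 + 2 * κ₀ := by positivity
  have hκ₁' : 0 ≤ 2 * κ₁ := by positivity
  have hκ'c : Continuous κ' := continuous_iff_continuousAt.2 fun t => (hκ' t).continuousAt
  have hsub : Icc lo hi ⊆ Icc (-hi) hi := Icc_subset_Icc (by linarith only [hlo, hlohi]) le_rfl
  have hwW' : ∀ e ∈ Icc (-hi) hi, |wt e| ≤ W := fun e he => by
    rw [abs_of_nonneg (hw0 e he)]; exact hwW e he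
  have hC8 : 8 * (1 + 2 * κ₀) ≤ C := le_trans (by nlinarith) hC0
  obtain ⟨hK2d, -, hK1p, hK2p, hcomp, hKopp, hKc⟩ :=
    ppMidKernelS_rows (hi := hi) hβ hΛ hB₁ hB₂ hB₃ hκ hκ' hκ''c hκb hκ'b hκ''b ht₀ ht25 hκs hκ's hκ''s hκ1 hκ'1 hκ''1 hlo hloΛ hC hC1 hC2
  refine ⟨fun e _ => ((contDiff_two_ppMidKernelS_u hβ hΛ hB₁ hB₂ hκ hκ' hκ''c hlo e).of_le (by norm_num)).div_const C, hK2d,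
    fun e _ he u => abs_div_le_of_le (abs_ppFarKernelS_le_inv_max hβ hΛ hB₁ hlo hκb he u).2 hC0 hC (by positivity),
    midSRow_hK0s hβ hΛ hκb hlo hloΛ hC hC8, fun e _ he u => ?_, fun e he u => hK2p e (hlo.trans_le he.1) u, hcomp, hKopp, hKc,
    fun D hD hDhi => midS_hflatB_row hβ hΛ hB₁ hB₂ hκ hκ'c hκb hκ'b ht₀ ht25 hκs hκ's hκ1 hκ'1 hlo hloΛ hC hC1 hCs hlohi hwc hwW' hW' hwL hD hDhi,
    fun s hs u hu => ?_,
    familyRow_hρ0 hβ hΛ hC hB10 hB20 hκ₀' hκ₁' hlo,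
    familyRow_hρc (β := β) (B₁ := B₁) (B₂ := B₂) (κ₀ := 1 + 2 * κ₀) (κ₁ := 2 * κ₁) (C := C) hΛ hlo,
    familyRow_hρtail hβ hΛ hC hB10 hB20 hκ₀' hκ₁' hlo, fun e he u => ?_⟩
  · rw [deriv_div_const]
    exact abs_div_le_of_le (abs_deriv_ppMidKernelS_le_abs hβ hΛ hB₁ hB₂ hκ hκb hκ'b ht₀ ht25 hκs hκ's hκ1 hκ'1 hlo hloΛ he u) hC1 hC (by positivity)
  · rw [deriv_div_const, abs_div, abs_of_pos hC, div_mul_eq_mul_div]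
    exact div_le_div_of_nonneg_right (abs_deriv_ppMidKernelS_negLevel_row hβ hΛ hB₁ hB₂ hκ hκb hκ'b hlo s hs u hu) hC.le
  · rw [deriv_div_const]
    have he' : |e| ≤ lo := abs_le.2 ⟨he.1, he.2⟩
    exact abs_div_le_of_le (abs_deriv_ppMidKernelS_strip_le hβ hΛ hB₁ hκ hκb hκ'b hlo hloΛ he' u) hCs hC (by positivity)

include hβ hΛ hB₁ hB₂ hκb hκ'b ht₀ ht25 hlo hC in
/-- The law constants of the bundle: `4 ≤ q_c`, `0 ≤ C_t`, `0 ≤ A_fl`, `0 ≤ B_fl`, `0 ≤ M_ρ` (the laws' `hqc`, `hCt`, `hAfl`, `hBfl`, `hMρ` rows), for `0 ≤ W, W′`,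
`0 < hi`. [folklore] -/
theorem ppMidKernelS_lawConsts {W W' : ℝ} (hW : 0 ≤ W) (hW' : 0 ≤ W') (hhi : 0 < hi) :
    4 ≤ 2 * ((2 - t₁) / t₁) ∧
    0 ≤ (8 * ((2 - t₁) / t₁) * (Λ / lo) * ((1 + 2 * κ₀) * (128 * B₂ + 216 * B₁ + 294 + (48 * B₁ + 28) * ((2 - t₁) / t₁)) + 2 * κ₁ * (12 * B₁ + 9)) +
          ((1 + 2 * κ₀) * (48 * ((2 - t₁) / t₁) ^ 3) + 16 * κ₁ * ((2 - t₁) / t₁) ^ 2) / (β * lo)) / C ∧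
    0 ≤ W * (65 + 32 * ((2 - t₁) / t₁) * (Λ + lo) / lo + (12 * (1 + 2 * κ₀) / β + 4 * κ₁ * ((2 - t₁) / t₁) * lo + (1 + 2 * κ₀) * hi) / (C * lo)) ∧
    0 ≤ 4 * (2 * ((2 - t₁) / t₁) + 3 / 2) * W' ∧
    0 ≤ (32 * ((1 + 2 * κ₀) * (64 * B₂ + 120 * B₁ + 154) + (2 * κ₁) * (12 * B₁ + 9)) * (Λ / lo) ^ 3 +
          32 * ((1 + 2 * κ₀) * ((β * lo) ^ 2 + 2) + (2 * κ₁) * (β * lo + 1)) / (β * lo) ^ 3) / C := by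
  have hB10 : 0 ≤ B₁ := salmhoferB₁_nonneg hB₁
  have hB20 : 0 ≤ B₂ := (abs_nonneg _).trans (hB₂ 0)
  have hκ₀ : 0 ≤ κ₀ := (abs_nonneg _).trans (hκb 0 (left_mem_Icc.2 zero_le_one))
  have hκ₁ : 0 ≤ κ₁ := (abs_nonneg _).trans (hκ'b 0 (left_mem_Icc.2 zero_le_one))
  have hq4 : 4 ≤ (2 - t₁) / t₁ := midRatio_ge_four ht₀ ht25
  have hq0 : 0 ≤ (2 - t₁) / t₁ := by linarith
  exact ⟨by linarith, by positivity, by positivity, by positivity, by positivity⟩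

/-- **Row constants of the concrete split profile for `M_s`**: with `κ₀ = 1`, `κ₁ = 6/t₁`, `κ₂ = 8388608/t₁²` (`ppSplitProfile_admissible`), the sum
`Cᴹ(B₁,B₂,B₃,t₁) := C₀ᴹ + C₁ᴹ + C₂ᴹ + Cˢᴹ` is positive and dominates each of the four row constants (`0 ≤ B₁, B₂, B₃`, `0 < t₁ ≤ 2/5`). [folklore] -/
theorem ppSplit_rowConstsMidS {B₁ B₂ B₃ t₁ : ℝ} (hB₁ : 0 ≤ B₁) (hB₂ : 0 ≤ B₂) (hB₃ : 0 ≤ B₃) (ht₀ : 0 < t₁) (ht25 : t₁ ≤ 2 / 5) :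
    0 < ((1 + 2 * 1) * (12 * B₁ + 9) +
      ((1 + 2 * 1) * (128 * B₂ + 216 * B₁ + 294 + (48 * B₁ + 28) * ((2 - t₁) / t₁)) + 2 * (6 / t₁) * (12 * B₁ + 9)) +
      ((1 + 2 * 1) * (512 * B₃ + 1664 * B₂ + 5280 * B₁ + 3424 + (256 * B₂ + 384 * B₁ + 504) * ((2 - t₁) / t₁) ^ 2 + (192 * B₁ + 112) * ((2 - t₁) / t₁)) +
          4 * (6 / t₁) * (128 * B₂ + 216 * B₁ + 294 + (48 * B₁ + 28) * ((2 - t₁) / t₁)) +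
          (12 * B₁ + 9) * (2 * (8388608 / t₁ ^ 2) + 2 * (6 / t₁) * ((2 - t₁) / t₁ + 2))) +
      ((1 + 2 * 1) * (128 * B₁ + 72) + 16 * (6 / t₁))) ∧
    (1 + 2 * 1) * (12 * B₁ + 9) ≤ ((1 + 2 * 1) * (12 * B₁ + 9) +
      ((1 + 2 * 1) * (128 * B₂ + 216 * B₁ + 294 + (48 * B₁ + 28) * ((2 - t₁) / t₁)) + 2 * (6 / t₁) * (12 * B₁ + 9)) +
      ((1 + 2 * 1) * (512 * B₃ + 1664 * B₂ + 5280 * B₁ + 3424 + (256 * B₂ + 384 * B₁ + 504) * ((2 - t₁) / t₁) ^ 2 + (192 * B₁ + 112) * ((2 - t₁) / t₁)) +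
          4 * (6 / t₁) * (128 * B₂ + 216 * B₁ + 294 + (48 * B₁ + 28) * ((2 - t₁) / t₁)) +
          (12 * B₁ + 9) * (2 * (8388608 / t₁ ^ 2) + 2 * (6 / t₁) * ((2 - t₁) / t₁ + 2))) +
      ((1 + 2 * 1) * (128 * B₁ + 72) + 16 * (6 / t₁))) ∧
    (1 + 2 * 1) * (128 * B₂ + 216 * B₁ + 294 + (48 * B₁ + 28) * ((2 - t₁) / t₁)) + 2 * (6 / t₁) * (12 * B₁ + 9) ≤
      ((1 + 2 * 1) * (12 * B₁ + 9) +
      ((1 + 2 * 1) * (128 * B₂ + 216 * B₁ + 294 + (48 * B₁ + 28) * ((2 - t₁) / t₁)) + 2 * (6 / t₁) * (12 * B₁ + 9)) +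
      ((1 + 2 * 1) * (512 * B₃ + 1664 * B₂ + 5280 * B₁ + 3424 + (256 * B₂ + 384 * B₁ + 504) * ((2 - t₁) / t₁) ^ 2 + (192 * B₁ + 112) * ((2 - t₁) / t₁)) +
          4 * (6 / t₁) * (128 * B₂ + 216 * B₁ + 294 + (48 * B₁ + 28) * ((2 - t₁) / t₁)) +
          (12 * B₁ + 9) * (2 * (8388608 / t₁ ^ 2) + 2 * (6 / t₁) * ((2 - t₁) / t₁ + 2))) +
      ((1 + 2 * 1) * (128 * B₁ + 72) + 16 * (6 / t₁))) ∧
    (1 + 2 * 1) * (512 * B₃ + 1664 * B₂ + 5280 * B₁ + 3424 + (256 * B₂ + 384 * B₁ + 504) * ((2 - t₁) / t₁) ^ 2 + (192 * B₁ + 112) * ((2 - t₁) / t₁)) +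
          4 * (6 / t₁) * (128 * B₂ + 216 * B₁ + 294 + (48 * B₁ + 28) * ((2 - t₁) / t₁)) +
          (12 * B₁ + 9) * (2 * (8388608 / t₁ ^ 2) + 2 * (6 / t₁) * ((2 - t₁) / t₁ + 2)) ≤
      ((1 + 2 * 1) * (12 * B₁ + 9) +
      ((1 + 2 * 1) * (128 * B₂ + 216 * B₁ + 294 + (48 * B₁ + 28) * ((2 - t₁) / t₁)) + 2 * (6 / t₁) * (12 * B₁ + 9)) +
      ((1 + 2 * 1) * (512 * B₃ + 1664 * B₂ + 5280 * B₁ + 3424 + (256 * B₂ + 384 * B₁ + 504) * ((2 - t₁) / t₁) ^ 2 + (192 * B₁ + 112) * ((2 - t₁) / t₁)) +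
          4 * (6 / t₁) * (128 * B₂ + 216 * B₁ + 294 + (48 * B₁ + 28) * ((2 - t₁) / t₁)) +
          (12 * B₁ + 9) * (2 * (8388608 / t₁ ^ 2) + 2 * (6 / t₁) * ((2 - t₁) / t₁ + 2))) +
      ((1 + 2 * 1) * (128 * B₁ + 72) + 16 * (6 / t₁))) ∧
    (1 + 2 * 1) * (128 * B₁ + 72) + 16 * (6 / t₁) ≤ ((1 + 2 * 1) * (12 * B₁ + 9) +
      ((1 + 2 * 1) * (128 * B₂ + 216 * B₁ + 294 + (48 * B₁ + 28) * ((2 - t₁) / t₁)) + 2 * (6 / t₁) * (12 * B₁ + 9)) +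
      ((1 + 2 * 1) * (512 * B₃ + 1664 * B₂ + 5280 * B₁ + 3424 + (256 * B₂ + 384 * B₁ + 504) * ((2 - t₁) / t₁) ^ 2 + (192 * B₁ + 112) * ((2 - t₁) / t₁)) +
          4 * (6 / t₁) * (128 * B₂ + 216 * B₁ + 294 + (48 * B₁ + 28) * ((2 - t₁) / t₁)) +
          (12 * B₁ + 9) * (2 * (8388608 / t₁ ^ 2) + 2 * (6 / t₁) * ((2 - t₁) / t₁ + 2))) +
      ((1 + 2 * 1) * (128 * B₁ + 72) + 16 * (6 / t₁))) := by
  have hq0 : 0 ≤ (2 - t₁) / t₁ := le_trans (by norm_num) (midRatio_ge_four ht₀ ht25)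
  have h0 : 0 < (1 + 2 * 1) * (12 * B₁ + 9) := by positivity
  have h1 : 0 ≤ (1 + 2 * 1) * (128 * B₂ + 216 * B₁ + 294 + (48 * B₁ + 28) * ((2 - t₁) / t₁)) + 2 * (6 / t₁) * (12 * B₁ + 9) := by positivity
  have h2 : 0 ≤ (1 + 2 * 1) * (512 * B₃ + 1664 * B₂ + 5280 * B₁ + 3424 + (256 * B₂ + 384 * B₁ + 504) * ((2 - t₁) / t₁) ^ 2 + (192 * B₁ + 112) * ((2 - t₁) / t₁)) +
          4 * (6 / t₁) * (128 * B₂ + 216 * B₁ + 294 + (48 * B₁ + 28) * ((2 - t₁) / t₁)) +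
          (12 * B₁ + 9) * (2 * (8388608 / t₁ ^ 2) + 2 * (6 / t₁) * ((2 - t₁) / t₁ + 2)) := by
    positivity
  have h3 : 0 ≤ (1 + 2 * 1) * (128 * B₁ + 72) + 16 * (6 / t₁) := by positivity
  exact ⟨by linarith, by linarith, by linarith, by linarith, by linarith⟩

end LawBundle

end Summit.HubbardSuperconductivity.HubbardSuperconductivity.Theorems.C4a

end
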